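import Summits.CriticalPhenomena.SAWScalingLimit.Theorems.SAWLoopFugacityFlowIsingBoundaryRatioWindowResistanceDefs
import Literature.Analysis.Complex.ExtremalLength
import HarnessLib

/-!
# Resistance bound for the window rectangle — averaging over the log-polar rectangle
(line `fk-anchor-transfer`, crux `IsingBoundaryRatio`, stmt-CriticalPhenomena-10650; helper module of the proof of
`WindowExtResistanceBound`, `…IsingBoundaryRatioWindowResistanceDefs.lean`)

The integral-geometric step of the elementary direction of Chelkak 2016, Prop. 6.2 (i) (the classical
upper bound for the extremal length of a quadrilateral, Ahlfors, *Conformal invariants* (1973), §4-2, here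
transported to the conformal half-annulus by the holomorphic injection `ζ ↦ φ(e^ζ)` of the rectangle
`(s₁, s₂) × (0, π)`):

* `wer_sq_mul_le_lintegral_sq` — if a number `L` is bounded by the `g`-length
  `∫₀^π g(φ(e^{s+iθ})) |∂_θ φ(e^{s+iθ})| dθ` of every chart semicircle `φ({|w| = e^s} ∩ ℍ)`, `s ∈ (s₁, s₂)`,
  then `L² (s₂ - s₁) ≤ π ∬_ℂ g²` — Tonelli on the rectangle (`wer_lintegral_reProdIm`, inner integral over
  the imaginary part), the area formula for the pulled-back metric (`ExtremalLength.area_pullbackMetric`,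
  injectivity of `exp` on the strip `wer_injOn_exp_strip`) and Cauchy–Schwarz
  (`ExtremalLength.lintegral_sq_le_area_mul`).

All statements are folklore.
-/

noncomputable section

open scoped Classical Topology ENNReal NNReal
open Filter Set Metric MeasureTheory Complex
open Literature.Probability.LatticeModels Literature.Probability.RandomPlanarGeometry
open Literature.Analysis.Complex Literature.Analysis.Complex.ExtremalLength
open UpperHalfPlane (upperHalfPlaneSet)

namespace Summit.CriticalPhenomena.SAWScalingLimit.Theorems.IsingBoundaryRatio

/-- **Tonelli on a rectangle**, inner integral over the imaginary part:
`∬_{(a,b)×(c,d)} f = ∫ₐᵇ (∫_c^d f(x + iy) dy) dx` for Borel `f`. [folklore] -/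
theorem wer_lintegral_reProdIm {f : ℂ → ℝ≥0∞} (hf : Measurable f) (a b c d : ℝ) :
    ∫⁻ z in Ioo a b ×ℂ Ioo c d, f z = ∫⁻ x in Ioo a b, ∫⁻ y in Ioo c d, f ((x : ℂ) + (y : ℂ) * I) := by
  have hF : Measurable fun p : ℝ × ℝ => f ((p.1 : ℂ) + (p.2 : ℂ) * I) :=
    hf.comp (by fun_prop : Continuous fun p : ℝ × ℝ => (p.1 : ℂ) + (p.2 : ℂ) * I).measurable
  have h1 : ∫⁻ z in Ioo a b ×ℂ Ioo c d, f z = ∫⁻ p in Ioo a b ×ˢ Ioo c d, f ((p.1 : ℂ) + (p.2 : ℂ) * I) := by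
    have h := (volume_preserving_equiv_real_prod.symm measurableEquivRealProd).setLIntegral_comp_preimage_emb
      measurableEquivRealProd.symm.measurableEmbedding f (Ioo a b ×ℂ Ioo c d)
    have hpre : measurableEquivRealProd.symm ⁻¹' (Ioo a b ×ℂ Ioo c d) = Ioo a b ×ˢ Ioo c d := by
      ext p
      simp [mem_reProdIm]
    rw [← h, hpre]
    refine setLIntegral_congr_fun (measurableSet_Ioo.prod measurableSet_Ioo) fun p _ => ?_
    rw [measurableEquivRealProd_symm_apply, Complex.mk_eq_add_mul_I]
  rw [h1, Measure.volume_eq_prod, ← Measure.prod_restrict, lintegral_prod _ hF.aemeasurable]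

/-- `exp` maps the strip `{0 < im < π}` into the upper half-plane. [folklore] -/
theorem wer_exp_mem_upperHalfPlane {ζ : ℂ} (h1 : 0 < ζ.im) (h2 : ζ.im < Real.pi) : exp ζ ∈ upperHalfPlaneSet := by
  show 0 < (exp ζ).im
  rw [Complex.exp_im]
  exact mul_pos (Real.exp_pos _) (Real.sin_pos_of_pos_of_lt_pi h1 h2)

/-- `exp` is injective on the strip `{0 < im < π}`. [folklore] -/
theorem wer_injOn_exp_strip (s₁ s₂ : ℝ) : InjOn exp (Ioo s₁ s₂ ×ℂ Ioo 0 Real.pi) := by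
  intro ζ hζ ζ' hζ' h
  rw [mem_reProdIm] at hζ hζ'
  obtain ⟨n, hn⟩ := Complex.exp_eq_exp_iff_exists_int.1 h
  have him := congrArg Complex.im hn
  simp only [add_im, mul_im, intCast_re, intCast_im, mul_re, re_ofNat, ofReal_re, im_ofNat, ofReal_im,
    mul_zero, sub_zero, I_re, I_im, mul_one, zero_mul, add_zero] at him
  have h3 : ((n : ℝ)) * (2 * Real.pi) = ζ.im - ζ'.im := by linarith
  have hlt : |(n : ℝ) * (2 * Real.pi)| < 1 * (2 * Real.pi) := by
    rw [h3, abs_lt]; constructor <;> nlinarith [hζ.2.1, hζ.2.2, hζ'.2.1, hζ'.2.2, Real.pi_pos]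
  rw [abs_mul, abs_of_pos (by positivity : (0 : ℝ) < 2 * Real.pi)] at hlt
  have hn0 : |(n : ℝ)| < 1 := lt_of_mul_lt_mul_right hlt (by positivity)
  have : n = 0 := by
    rw [← Int.cast_abs] at hn0
    have : |n| < 1 := by exact_mod_cast hn0
    rw [abs_lt] at this
    omega
  rw [this] at hn
  simpa using hn

/-- **Averaging over the log-polar rectangle** (Ahlfors' argument for the extremal distance of a rectangle,
transported by `φ ∘ exp`): if `L ≤ ∫₀^π g(φ(e^{s+iθ})) |∂_θ φ(e^{s+iθ})| dθ` for every `s ∈ (s₁, s₂)`, then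
`L² (s₂ - s₁) ≤ π ∬ g²` (Tonelli, the area formula for the injective holomorphic map `φ ∘ exp` on the
rectangle `(s₁, s₂) × (0, π)`, Cauchy–Schwarz). [folklore] -/
theorem wer_sq_mul_le_lintegral_sq {U : Set ℂ} (φ : ConformalEquiv upperHalfPlaneSet U) {s₁ s₂ : ℝ}
    (hs : s₁ < s₂) {g : ℂ → ℝ≥0∞} (hg : Measurable g) {L : ℝ≥0∞}
    (hL : ∀ s ∈ Ioo s₁ s₂, L ≤ ∫⁻ θ in Ioo 0 Real.pi,
      g (φ (exp ((s : ℂ) + (θ : ℂ) * I))) * ‖deriv (fun θ : ℝ => φ (exp ((s : ℂ) + (θ : ℂ) * I))) θ‖ₑ) :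
    L ^ 2 * ENNReal.ofReal (s₂ - s₁) ≤ ENNReal.ofReal Real.pi * ∫⁻ z, g z ^ 2 := by
  set R : Set ℂ := Ioo s₁ s₂ ×ℂ Ioo 0 Real.pi with hR
  set Φ : ℂ → ℂ := fun ζ => φ (exp ζ) with hΦ
  have hRo : IsOpen R := isOpen_Ioo.reProdIm isOpen_Ioo
  have hmaps : MapsTo exp R upperHalfPlaneSet := fun ζ hζ => by
    rw [hR, mem_reProdIm] at hζ
    exact wer_exp_mem_upperHalfPlane hζ.2.1 hζ.2.2
  have hΦd : DifferentiableOn ℂ Φ R :=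
    φ.differentiableOn.comp Complex.differentiable_exp.differentiableOn hmaps
  have hΦinj : InjOn Φ R := φ.injOn.comp (wer_injOn_exp_strip s₁ s₂) hmaps
  have hpbm : Measurable (pullbackMetric Φ R g) := measurable_pullbackMetric hRo hΦd.continuousOn hg
  -- the inner integrals
  have hderiv : ∀ s θ : ℝ, (s : ℂ) + (θ : ℂ) * I ∈ R →
      HasDerivAt (fun θ : ℝ => Φ ((s : ℂ) + (θ : ℂ) * I)) (deriv Φ ((s : ℂ) + (θ : ℂ) * I) * I) θ := by
    intro s θ hmem
    have hΦat : HasDerivAt Φ (deriv Φ ((s : ℂ) + (θ : ℂ) * I)) ((s : ℂ) + (θ : ℂ) * I) :=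
      (hΦd.differentiableAt (hRo.mem_nhds hmem)).hasDerivAt
    have hlin : HasDerivAt (fun w : ℂ => (s : ℂ) + w * I) I (θ : ℂ) := by
      simpa using ((hasDerivAt_id (θ : ℂ)).mul_const I).const_add (s : ℂ)
    have hcomp := hΦat.comp (θ : ℂ) hlin
    exact hcomp.comp_ofReal
  have hinner : ∀ s ∈ Ioo s₁ s₂, L ≤ ∫⁻ θ in Ioo 0 Real.pi, pullbackMetric Φ R g ((s : ℂ) + (θ : ℂ) * I) := by
    intro s hs
    refine (hL s hs).trans (le_of_eq (setLIntegral_congr_fun measurableSet_Ioo fun θ hθ => ?_))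
    have hmem : (s : ℂ) + (θ : ℂ) * I ∈ R := by
      rw [hR, mem_reProdIm]; simpa using ⟨hs, hθ⟩
    rw [pullbackMetric, indicator_of_mem hmem, (hderiv s θ hmem).deriv, enorm_mul,
      show ‖(I : ℂ)‖ₑ = 1 by rw [← ofReal_norm, Complex.norm_I, ENNReal.ofReal_one], mul_one]
  -- Tonelli and the lower bound
  have h1 : L * ENNReal.ofReal (s₂ - s₁) ≤ ∫⁻ z in R, pullbackMetric Φ R g z := by
    have hv : volume (Ioo s₁ s₂) = ENNReal.ofReal (s₂ - s₁) := Real.volume_Ioo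
    rw [hR, wer_lintegral_reProdIm hpbm, ← hv, ← setLIntegral_const]
    refine lintegral_mono_ae ((ae_restrict_iff' measurableSet_Ioo).2 (Eventually.of_forall ?_))
    intro s hs
    exact hinner s hs
  -- Cauchy–Schwarz and the area formula
  have hvol : volume R = ENNReal.ofReal (s₂ - s₁) * ENNReal.ofReal Real.pi := by
    rw [hR, volume_reProdIm, Real.volume_Ioo, Real.volume_Ioo, sub_zero]
  have h2 : (∫⁻ z in R, pullbackMetric Φ R g z) ^ 2 ≤ (∫⁻ z, g z ^ 2) * (ENNReal.ofReal (s₂ - s₁) * ENNReal.ofReal Real.pi) := by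
    refine (lintegral_sq_le_area_mul hpbm R).trans ?_
    rw [hvol, area_pullbackMetric hRo hΦd hΦinj]
    gcongr
    exact (area_mono (subset_univ _) g).trans (le_of_eq (by simp [area]))
  have h3 : (L * ENNReal.ofReal (s₂ - s₁)) ^ 2 ≤ (∫⁻ z, g z ^ 2) * (ENNReal.ofReal (s₂ - s₁) * ENNReal.ofReal Real.pi) :=
    (pow_le_pow_left' h1 2).trans h2
  have hne0 : ENNReal.ofReal (s₂ - s₁) ≠ 0 := (ENNReal.ofReal_pos.2 (by linarith)).ne'
  rw [mul_pow, sq (ENNReal.ofReal (s₂ - s₁)), ← mul_assoc,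
    show (∫⁻ z, g z ^ 2) * (ENNReal.ofReal (s₂ - s₁) * ENNReal.ofReal Real.pi) =
      ENNReal.ofReal Real.pi * (∫⁻ z, g z ^ 2) * ENNReal.ofReal (s₂ - s₁) by ring] at h3
  exact (ENNReal.mul_le_mul_iff_left hne0 ENNReal.ofReal_ne_top).1 h3

/-- `wer_injOn_exp_strip`, closed form (registered sub-goal of stmt-CriticalPhenomena-10650). [folklore] -/
theorem wer_injOn_exp_strip' : ∀ (s₁ s₂ : ℝ), InjOn exp (Ioo s₁ s₂ ×ℂ Ioo 0 Real.pi) :=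
  wer_injOn_exp_strip

end Summit.CriticalPhenomena.SAWScalingLimit.Theorems.IsingBoundaryRatio

end
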